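import Summits.CriticalPhenomena.PercolationContinuityZ3.Theorems.FK.SusceptibilitySumRule
import Mathlib.Analysis.SpecialFunctions.Integrals.Basic
import HarnessLib

/-!
# A MODULUS OF CONTINUITY OF THE MAGNETISATION IN THE FIELD: `0 ≤ m(β,h') − m(β,h) ≤ (1 − m*(β)) log(h'/h)` and
# `≤ (m(β,h) − m*(β)) (h' − h)/h` for `0 < h ≤ h'` (consequences of the sum rule and the sharp GHS bound)

Claimed R42 (8)(c) in the cell INBOX at 2026-08-28T23:16:28Z by fkp-10a gen 356 (NEW CLAIM #3 of the gen), addressed to coordinator fk-4 gen 283 (seated 21:31Z 2026-08-28 by l.8554; R157 / R158 in force); lineage row FO-10a-g356s (self-suggested), package g356-sumrules, label SR-C.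
Helper file of the `fk-continuity` build cell (bschramm lane; `--supports stmt-CriticalPhenomena-4575`); builds on
p205010 (kernel theorem, internal audit signed; external expert review pending). No definitions, no named facts, no
sorries; standard axioms. UNCONDITIONAL (nearest-neighbour Ising model on `ℤ^d`, every `d`).

From `SusceptibilitySumRule` (`m(β,h') − m(β,h) = ∫_h^{h'} β σ²(β,t) dt`, `β σ²(β,t) ≤ (m(β,t) − m*(β))/t ≤ (1 − m*(β))/t`,
and `t ↦ (m(β,t) − m*(β))/t` nonincreasing):

* `magnetizationInField_sub_nonneg` — `0 ≤ m(β,h') − m(β,h)` for `0 ≤ h ≤ h'`;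
* **`magnetizationInField_sub_le_mul_log`** — `m(β,h') − m(β,h) ≤ (1 − m*(β)) · log(h'/h)` for `β > 0`, `0 < h ≤ h'`
  (integrate `β σ²(β,t) ≤ (1 − m*(β))/t`): a logarithmic modulus of continuity, uniform in `β`;
* **`magnetizationInField_sub_le_mul_div`** — `m(β,h') − m(β,h) ≤ (m(β,h) − m*(β)) (h' − h)/h` (integrate the
  nonincreasing chord slope): the magnetisation curve stays below its chord from `(0, m*)` through `(h, m(h))`.

## References

* R. S. Ellis, *Entropy, Large Deviations, and Statistical Mechanics*, Springer (1985/2006), Lemma V.7.4,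
  Thm. V.7.2 (b). [Ellis2006]
* S. Friedli, Y. Velenik, *Statistical Mechanics of Lattice Systems*, CUP (2017), Remark 3.41, §3.7.4. [FriedliVelenik2017]
-/

noncomputable section

namespace Summit.CriticalPhenomena.PercolationContinuityZ3.Theorems.FK

namespace IsingSusceptibility

open MeasureTheory Filter Topology Finset Set intervalIntegral
open scoped symmDiff
open Literature.Probability.LatticeModels
open Summit.CriticalPhenomena.PercolationContinuityZ3.Theorems.FK.IsingCLT

variable {d : ℕ}

/-- `0 ≤ m(β,h') − m(β,h)` for `β ≥ 0`, `0 ≤ h ≤ h'` (monotonicity in the field). [cite: FriedliVelenik2017, Lemma 3.31 (1)] -/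
theorem magnetizationInField_sub_nonneg {β h h' : ℝ} (hβ : 0 ≤ β) (hh : 0 ≤ h) (hhh' : h ≤ h') :
    0 ≤ magnetizationInField d β h' - magnetizationInField d β h :=
  sub_nonneg.2 (monotoneOn_magnetizationInField (d := d) hβ (mem_Ici.2 hh) (mem_Ici.2 (hh.trans hhh')) hhh')

/-- **LOGARITHMIC MODULUS OF CONTINUITY: `m(β,h') − m(β,h) ≤ (1 − m*(β)) log(h'/h)`** for `β > 0`, `0 < h ≤ h'`
(the sum rule `m(h') − m(h) = ∫_h^{h'} β σ²` and the sharp GHS bound `β σ²(β,t) ≤ (1 − m*(β))/t`).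
[cite: Ellis2006, Lemma V.7.4 and Thm. V.7.2 (b); FriedliVelenik2017, Remark 3.41] -/
theorem magnetizationInField_sub_le_mul_log {β h h' : ℝ} (hβ : 0 < β) (hh : 0 < h) (hhh' : h ≤ h') :
    magnetizationInField d β h' - magnetizationInField d β h ≤
      (1 - spontaneousMagnetization d β) * Real.log (h' / h) := by
  have hh' : 0 < h' := hh.trans_le hhh'
  rw [← integral_mul_tsum_plusTruncated_eq (d := d) hβ hh hhh', ← integral_one_div_of_pos hh hh',
    ← intervalIntegral.integral_const_mul]
  refine intervalIntegral.integral_mono_on hhh'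
    ((intervalIntegrable_tsum_plusTruncated hβ hh hh').const_mul β)
    ((intervalIntegral.intervalIntegrable_one_div (fun t ht => ?_) continuousOn_id).const_mul _) fun t ht => ?_
  · rw [uIcc_of_le hhh'] at ht; exact (hh.trans_le ht.1).ne'
  · have ht0 : 0 < t := hh.trans_le ht.1
    have := tsum_plusTruncated_le_one_sub_div (d := d) hβ ht0
    rw [le_div_iff₀ (mul_pos hβ ht0)] at this
    rw [mul_one_div, le_div_iff₀ ht0]
    linarith

/-- **`m(β,h') − m(β,h) ≤ (m(β,h) − m*(β)) (h' − h)/h`** for `β > 0`, `0 < h ≤ h'`: the chord slopes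
`(m(β,t) − m*(β))/t` from the left endpoint are nonincreasing, so `β σ²(β,t) ≤ (m(β,h) − m*(β))/h` on `[h, h']`.
[cite: FriedliVelenik2017, Remark 3.41] -/
theorem magnetizationInField_sub_le_mul_div {β h h' : ℝ} (hβ : 0 < β) (hh : 0 < h) (hhh' : h ≤ h') :
    magnetizationInField d β h' - magnetizationInField d β h ≤
      (magnetizationInField d β h - spontaneousMagnetization d β) * ((h' - h) / h) := by
  have hh' : 0 < h' := hh.trans_le hhh'
  have hconst : ∫ _ in h..h', (magnetizationInField d β h - spontaneousMagnetization d β) / h =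
      (magnetizationInField d β h - spontaneousMagnetization d β) * ((h' - h) / h) := by
    rw [intervalIntegral.integral_const, smul_eq_mul]; ring
  rw [← integral_mul_tsum_plusTruncated_eq (d := d) hβ hh hhh', ← hconst]
  refine intervalIntegral.integral_mono_on hhh' ((intervalIntegrable_tsum_plusTruncated hβ hh hh').const_mul β)
    intervalIntegrable_const fun t ht => ?_
  have ht0 : 0 < t := hh.trans_le ht.1
  calc β * ∑' z : Site d, (plusCorr d β t ({0} ∆ {z}) - plusCorr d β t {0} * plusCorr d β t {z})
      ≤ (magnetizationInField d β t - spontaneousMagnetization d β) / t := mul_tsum_plusTruncated_le_slope hβ ht0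
    _ ≤ (magnetizationInField d β h - spontaneousMagnetization d β) / h :=
        antitoneOn_slope_magnetizationInField_zero (d := d) hβ.le hh ht0 ht.1

end IsingSusceptibility

end Summit.CriticalPhenomena.PercolationContinuityZ3.Theorems.FK

end
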